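import Summits.BirchSwinnertonDyer.BirchSwinnertonDyer.Theorems.SchneiderFreeAdditiveX3GordCellFiveLeOfCGLS
import Summits.BirchSwinnertonDyer.BirchSwinnertonDyer.Theorems.SchneiderFreeAdditiveX3GordTwoBranchIMCOfTree
import Summits.BirchSwinnertonDyer.BirchSwinnertonDyer.Theorems.SchneiderFreeAdditiveX3NATLambdaAlgebraicSide
import Summits.BirchSwinnertonDyer.BirchSwinnertonDyer.Theorems.SchneiderFreeAdditiveX3NATKYBranchThreeOfTree
import Summits.BirchSwinnertonDyer.BirchSwinnertonDyer.Theorems.EisensteinPrimesStrictEqUnramifiedDualTransfer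
import Summits.BirchSwinnertonDyer.BirchSwinnertonDyer.Theorems.EisensteinPrimesStrictEqUnramifiedCommutator
import HarnessLib

/-!
# Route `SchneiderFreeAdditiveX3` (K1 door): the (G-ord, `e = 2`) LOWER socket and crux r3's own currency AT `p ≥ 5` ON THE NAT INDEX ROAD (FILE E5a, §1) —
# CGLS 2022 Cor. 1.2.6 (i)(ii), Prop. 14 and Prop. 1.2.5's dimension clause LEAVE the `p ≥ 5` column; the only CGLS §1.2 input left is Prop. 1.2.5's module
# clause (torsion, `μ = 0` of the strict character duals; its corank clause a tree theorem), read on the unramified duals along `grSelmer = unrSelmer`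
# (twins of generation 40's F38b `…GordCellFiveLeOfCGLS`)

Cell `bsd-schneider-ideate`, seat `bsd-schneider-door-c5` (prover, generation 43; assembly layer; `--supports` 19177).  PARTITION: board row
B6 ∩ X3 ∩ sst-twist, `r = 1`, (G-ord, `e = 2`) half at `p ≥ 5` (149 of 2 560 census pairs; class-wide every `p ≥ 5`) of `Rank1Residual.partition` — ASSEMBLY;
types-the-object-of nothing new; RE-KEYS F38b's `exists_firstUnitCoeffAt_le_lambdaInvariant_five_le` / `xac_charIdeal_map_eq_span_five_le_of_dvd` /
`xac_charIdeal_map_le_span_five_le_self_of_dvd` / `additiveIMCLowerBDPOnTree_subGordTwo_five_le_offSliver` / `additiveIMCLowerBDPInputManinAt_gordTwo_five_le` /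
`_of_ne_seven` off the CGLS count: the door inequality is FILE D's `NATLambdaAlgebraicSide.add_add_sum_le_lambdaInvariant_xAc_empty_add_sum_curveLocalLambda_of_decomp_ne_one`
(V21 index road in the «no local fixed vectors» orientation — AT `p ≥ 5` BOTH Jordan–Hölder characters of the door are ramified at `p` (this seat's F28a), hence
non-trivial on `D_v̄`: generation 25's `KYLambdaAlgChar.charHypotheses_of_nonAnomalous` on `SemistableTwistLocalAnyLine.not_fix_and_not_quot_…`).  Its two
primitive character clauses come from CGLS Prop. 1.2.5's MODULE clause (`hprop125`, with the corank clause `KYBranchOfTree.corank_ge_ofTree hprop125` a tree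
theorem) through `KYLambdaAlgOfCGLS.charLambdaRelaxation_eq_of_ge` and cell `bsd-eis`'s transfer `StrictEqUnramifiedCentral.prop_datumDualData_of_forall_grDualData`
along `grSelmer_charModule_eq_unrSelmer` (UNCONDITIONAL for `θ|_{D_v̄} ≠ 𝟙`); Keller–Yin's count ([AN-BR₅], stated on the strict duals) is moved to the unramified
duals by the same transfer.  The binders `hge`/`hfact`/`hlift`/`hlocal` and the Milne binder DISAPPEAR; `X_ac^∅(W_K)` torsion with `μ = 0` is RETURNED by FILE D
(no CGLS Prop. 14).  Proofs otherwise token-identical to F38b; closes none of B6's cells (BSD NOT advanced).  bears_on: K1-door (19177 r3 `GordTwoBranchIMC`).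

INPUT LEDGER of the `p ≥ 5` per-pair door after this file: Kolyvagin, Gross–Zagier, modularity, Par, CST 1.1 (sliver road), Hsieh A, LZZ, Castella–Hsieh
signed ∪ {[DIV.dvd], [AN-BR₅] PRE} ∪ {CGLS Prop. 1.2.5 (module clause)} ∪ {`KYReadSliver`} — Cor. 1.2.6 (i)(ii) GONE (F38b: + Cor. 1.2.6 ×2, Prop. 14, Milne).
HONEST FRAMING: compositions of tree theorems, CONDITIONAL BY NAME on the displayed published statements; no definition, no named fact, no `sorry`; nothing
analytic touched; nothing about BSD or a main conjecture asserted; «closes rung: none».  References: [KellerYin2024b] Thm. 3.3.6, Prop. 3.4.4, §3.5, Thm. 3.5.1,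
Lemma 2.3.8; [KellerYin2024] Thm. 1.4.1 (iii); [CastellaGrossiLeeSkinner2022] Prop. 1.2.5, Thm. 1.2.2 and its proof (strict = unramified); [CastellaHsieh2018] §3.3;
this seat p704268 / p704669 (gen 33), F38b (gen 40, the template), F44 (gen 41), F49a–e (gen 43).
-/

set_option autoImplicit false
set_option linter.dupNamespace false -- the summit namespace `…BirchSwinnertonDyer.BirchSwinnertonDyer.Theorems` (Sub = Summit, D-0017) trips it

noncomputable section

open scoped Classical Pointwise NumberField

open Field NumberField IsDedekindDomain WeierstrassCurve PowerSeries
  Literature.NumberTheory.EllipticCurves Literature.NumberTheory.EllipticCurves.IwasawaAlgebra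
  Literature.NumberTheory.EllipticCurves.GreenbergSelmer Literature.NumberTheory.EllipticCurves.GreenbergVatsal2000
  Literature.NumberTheory.GaloisRepresentations Literature.NumberTheory.GaloisCohomology IsDedekindDomain.HeightOneSpectrum
  Literature.NumberTheory.EllipticCurves.ModularForms Literature.NumberTheory.EllipticCurves.Rank1Residual
  Literature.NumberTheory.EllipticCurves.KellerYin2024 Literature.NumberTheory.EllipticCurves.CaiShuTian2014
  Literature.NumberTheory.EllipticCurves.IwasawaDual
  Literature.NumberTheory.IwasawaTheory Literature.NumberTheory.IwasawaTheory.Greenberg2016 Literature.NumberTheory.IwasawaTheory.Greenberg2006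
  Summit.BirchSwinnertonDyer.Rank1Residual Summit.BirchSwinnertonDyer.Rank1Residual.X11b Summit.BirchSwinnertonDyer.Rank1Residual.Additive
  Summit.BirchSwinnertonDyer.Rank1Residual.X11b.Halves Summit.BirchSwinnertonDyer.Rank1Residual.X11b.CongruenceLimit
  Summit.BirchSwinnertonDyer.BirchSwinnertonDyer.Theorems Summit.BirchSwinnertonDyer.BirchSwinnertonDyer.Theorems.SchneiderFree
  Summit.BirchSwinnertonDyer.BirchSwinnertonDyer.Theorems.SchneiderFree.KYRead
  Summit.BirchSwinnertonDyer.BirchSwinnertonDyer.Theses.SchneiderFreeAdditiveX3 Summit.BirchSwinnertonDyer.BirchSwinnertonDyer.Theorems.SchneiderFreeAdditiveX3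
  Summit.BirchSwinnertonDyer.BirchSwinnertonDyer.Theorems.SchneiderFreeAdditiveX3.LZZMatch
  Summit.BirchSwinnertonDyer.BirchSwinnertonDyer.Theorems.SchneiderFreeAdditiveX3.ControlDischarged
  Summit.BirchSwinnertonDyer.BirchSwinnertonDyer.Theorems.SchneiderFreeAdditiveX3.KYBranchOnly
  Summit.BirchSwinnertonDyer.BirchSwinnertonDyer.Theorems.SchneiderFreeAdditiveX3.KYMuZeroOfPrint
  Summit.BirchSwinnertonDyer.BirchSwinnertonDyer.Theorems.SchneiderFreeAdditiveX3.KYBranchHalves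
  Summit.BirchSwinnertonDyer.BirchSwinnertonDyer.Theorems.SchneiderFreeAdditiveX3.KYBranchThreeLattice
  Summit.BirchSwinnertonDyer.BirchSwinnertonDyer.Theorems.SchneiderFreeAdditiveX3.KYBranchThreeTorsion
  Summit.BirchSwinnertonDyer.BirchSwinnertonDyer.Theorems.SchneiderFreeAdditiveX3.KYLambdaAlgOfCGLS
  Summit.BirchSwinnertonDyer.BirchSwinnertonDyer.Theorems.EisensteinPrimesMuLambda
open Literature.NumberTheory.EllipticCurves.CastellaGrossiLeeSkinner2022
  (cor126_residualCharacter_globalLift cor126_residualCharacter_localSurjective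
    prop125_characterGrSelmerDual_torsion_muZero_dim prop125_characterGrSelmerDual_corank_ge prop14_residualCharacterSelmer_finite)

namespace Summit.BirchSwinnertonDyer.BirchSwinnertonDyer.Theorems.SchneiderFreeAdditiveX3.NATGordCellFiveLe

/-! ### §1 Keller–Yin Thm. 3.5.1 in branch currency at `p ≥ 5`, at a signed frame — CGLS-Cor.-1.2.6-free -/

section FiveLe
open Literature.NumberTheory.EllipticCurves.Castella2018.AcSelmer
variable {p : ℕ} [hp : Fact p.Prime]

/-- **[INV.λ≤] ∧ KYμ ∧ [INV.μ] at `p ≥ 5`, at a SIGNED Castella–Hsieh frame, ON THE NAT INDEX ROAD** — F38b's `exists_firstUnitCoeffAt_le_lambdaInvariant_five_le` with the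
door inequality from FILE D (`NATLambdaAlgebraicSide.…_of_decomp_ne_one`, no named hypothesis): at Keller–Yin's datum with `W` in the (G-ord, `e = 2`) cell (both
Jordan–Hölder characters ramified at `p`, hence non-trivial on `D_v̄`), a residual pair and a signed branch frame `L` of `(f′, χ_ε)`: `∃ n, FirstUnitCoeffAt L n ∧ n ≤
λ(X_ac^∅(W_K))`, AND `X_ac^∅(W_K)` is `Λ`-torsion with `μ = 0`.  The primitive character clauses: CGLS Prop. 1.2.5's module clause `hprop125` (corank clause from
the tree) through `charLambdaRelaxation_eq_of_ge`, transferred to the unramified duals along `grSelmer = unrSelmer` (`θ|_{D_v̄} ≠ 𝟙`); Keller–Yin's count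
([AN-BR₅], on the strict duals) transferred likewise. [claim: KellerYin2024PotOrd, status: under-review]
[cite: KellerYin2024b, §3.5, Thm. 3.5.1 and Lemma 2.3.8 (arXiv:2410.23241 pp. 11, 20) (preprint; hypotheses)] [cite: KellerYin2024, Thm. 1.4.1 (iii)]
[cite: CastellaGrossiLeeSkinner2022, Thm. 1.2.2 and proof, Prop. 1.2.5] -/
theorem exists_firstUnitCoeffAt_le_lambdaInvariant_five_le
    (hAN : thm351_anacong_charLambda_branch_five_le)
    (hprop125 : prop125_characterGrSelmerDual_torsion_muZero_dim)
    (hp5 : 5 ≤ p) (ι' : PadicAlgCl p ≃+* ℂ) (W : WeierstrassCurve ℚ) [W.IsElliptic] [W.IsGloballyMinimal]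
    (K : Type) [Field K] [NumberField K] [IsGalois ℚ K]
    (v vbar : HeightOneSpectrum (𝓞 K)) (κ : ZpExtension K p) (γ : absoluteGaloisGroup K)
    [hγ : Fact (κ.IsTopGenerator γ)] {N : ℕ} [NeZero N] {f : CuspForm (CongruenceSubgroup.Gamma0 N) 2}
    (hf : IsNewformOf W f) (hS : PotOrdSetting ι' W K v vbar κ N)
    (hX3 : ClassX3 W p) (hSG : SubGordTwo W p)
    (hv : ((p : ℕ) : 𝓞 K) ∈ v.asIdeal)
    {N' : ℕ} [NeZero N'] {f' : CuspForm (CongruenceSubgroup.Gamma0 N') 2} (hf' : IsNewform0 f') (hN' : ¬ p ∣ N')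
    (htw : ∃ S : Finset ℕ, ∀ ℓ : ℕ, ℓ.Prime → ℓ ∉ S →
      cuspCoeff f ℓ = ((legendreSym p ℓ : ℤ) : ℂ) * cuspCoeff f' ℓ)
    {θsub θquot : FramedGaloisRep K (padicCoeffIntegers (∅ : Set (PadicAlgCl p))) 1}
    (hpair : IsResidualPairOver (W.baseChange K) p θsub θquot)
    {e : ℂ} {ΩK : ℂ} {Ωp : (unrIntegers p)ˣ} {L : UnrSeries p} (he : e = 1 ∨ e = -1) (hΩK : ΩK ≠ 0)
    (hL : IsBranchBDPLFunction ι' v κ γ f' (KellerYin2024.genusHeckeCharacter K p) e ΩK ((Ωp : unrIntegers p) : ℂ_[p]) L) :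
    (∃ n : ℕ, FirstUnitCoeffAt L n ∧
      n ≤ lambdaInvariant p (XAc (W.baseChange K) p κ vbar (∅ : Set (HeightOneSpectrum (𝓞 K))) γ)) ∧
    (Module.IsTorsion (IwasawaAlgebra p) (XAc (W.baseChange K) p κ vbar (∅ : Set (HeightOneSpectrum (𝓞 K))) γ) ∧
      muInvariant p (XAc (W.baseChange K) p κ vbar (∅ : Set (HeightOneSpectrum (𝓞 K))) γ) = 0) := by
  obtain ⟨Sf, hSf⟩ := KYBranchFiveLe.exists_finset_primes_over_not (K := K) N p
  have hSf' : ∀ w : HeightOneSpectrum (𝓞 K), w ∈ Sf ↔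
      (((W.conductorNorm ℤ : ℤ) : 𝓞 K) ∈ w.asIdeal ∧ ((p : ℕ) : 𝓞 K) ∉ w.asIdeal) := by
    rw [hS.level]; exact hSf
  obtain ⟨n, hLn, hcount⟩ := hAN hp5 ι' W K v vbar κ γ hf hS hf' hN' htw θsub θquot hpair Sf hSf e ΩK Ωp L he hΩK hL
  have hp2 : 2 < p := by omega
  have hp2' : p ≠ 2 := by omega
  have hH : SatisfiesHeegnerHypothesis (W.conductorNorm ℤ) K := by rw [hS.level]; exact hS.heegner
  -- CGLS §1.2's character-level binders at `v̄` for BOTH members (both ramified at `p ≥ 5` on the cell, F28a ⇒ non-trivial on `D_v̄`)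
  obtain ⟨hS₀, hchar⟩ := KYLambdaAlgChar.charHypotheses_of_nonAnomalous W K vbar κ Sf hS.imagQuad hH hS.split hS.mem_vbar hSf'
    (fun _ hpv _ hΦ _ h𝔓 ↦
      SemistableTwistLocalAnyLine.not_fix_and_not_quot_of_classX3_of_subSemistableTwist_of_card_eq W p hp5 hX3 (Or.inr hSG) hpv h𝔓 hΦ)
    θsub θquot hpair
  obtain ⟨hTs, hunrs, hne1s, hneωs⟩ := hchar θsub (Or.inl rfl)
  obtain ⟨hTq, hunrq, hne1q, hneωq⟩ := hchar θquot (Or.inr rfl)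
  have hsubD := NATKYBranchThree.exists_unitChar_ne_one_of_not_forall_decomp vbar θsub hne1s
  have hquotD := NATKYBranchThree.exists_unitChar_ne_one_of_not_forall_decomp vbar θquot hne1q
  -- CGLS Prop. 1.2.5, MODULE clause (the corank clause a tree theorem): the PRIMITIVE strict clauses of both members
  have hge := KYBranchOfTree.corank_ge_ofTree hprop125
  obtain ⟨Gsub⟩ := nonempty_grDualData_char (∅ : Set (PadicAlgCl p)) θsub κ vbar (↑Sf : Set (HeightOneSpectrum (𝓞 K))) hγ.out
  obtain ⟨Gquot⟩ := nonempty_grDualData_char (∅ : Set (PadicAlgCl p)) θquot κ vbar (↑Sf : Set (HeightOneSpectrum (𝓞 K))) hγ.out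
  have hGs : ∀ G : GrDualData κ (charModule (∅ : Set (PadicAlgCl p)) θsub) vbar (∅ : Set (HeightOneSpectrum (𝓞 K))) γ,
      Module.Finite (IwasawaAlgebra p) G.X ∧ Module.IsTorsion (IwasawaAlgebra p) G.X ∧ muInvariant p G.X = 0 := fun G ↦ by
    obtain ⟨h1, h2, h3, -⟩ := KYLambdaAlgOfCGLS.charLambdaRelaxation_eq_of_ge hprop125 hge hS.imagQuad hp2' hS.split κ hS.anticyclotomic γ hγ.out
      vbar hS.mem_vbar θsub hTs Sf hS₀ hunrs hne1s hneωs Gsub G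
    exact ⟨h1, h2, h3⟩
  have hGq : ∀ G : GrDualData κ (charModule (∅ : Set (PadicAlgCl p)) θquot) vbar (∅ : Set (HeightOneSpectrum (𝓞 K))) γ,
      Module.Finite (IwasawaAlgebra p) G.X ∧ Module.IsTorsion (IwasawaAlgebra p) G.X ∧ muInvariant p G.X = 0 := fun G ↦ by
    obtain ⟨h1, h2, h3, -⟩ := KYLambdaAlgOfCGLS.charLambdaRelaxation_eq_of_ge hprop125 hge hS.imagQuad hp2' hS.split κ hS.anticyclotomic γ hγ.out
      vbar hS.mem_vbar θquot hTq Sf hS₀ hunrq hne1q hneωq Gquot G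
    exact ⟨h1, h2, h3⟩
  -- strict = unramified at `v̄` for both members (UNCONDITIONAL, `θ|_{D_v̄} ≠ 𝟙`), and the transfers of the clauses and of Keller–Yin's count
  have heqs := StrictEqUnramifiedCentral.grSelmer_charModule_eq_unrSelmer κ vbar (∅ : Set (HeightOneSpectrum (𝓞 K))) θsub hTs hne1s
  have heqq := StrictEqUnramifiedCentral.grSelmer_charModule_eq_unrSelmer κ vbar (∅ : Set (HeightOneSpectrum (𝓞 K))) θquot hTq hne1q
  have hRHs : ∀ D : DatumDualData κ γ (charModule (∅ : Set (PadicAlgCl p)) θsub)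
      (bdpData (charModule (∅ : Set (PadicAlgCl p)) θsub) p vbar) (∅ : Set (HeightOneSpectrum (𝓞 K))),
      Module.Finite (IwasawaAlgebra p) D.X ∧ Module.IsTorsion (IwasawaAlgebra p) D.X ∧ muInvariant p D.X = 0 := fun D ↦
    StrictEqUnramifiedCentral.prop_datumDualData_of_forall_grDualData κ vbar ∅ heqs
      (fun (X : Type) [AddCommGroup X] [Module (IwasawaAlgebra p) X] ↦
        Module.Finite (IwasawaAlgebra p) X ∧ Module.IsTorsion (IwasawaAlgebra p) X ∧ muInvariant p X = 0) hGs D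
  have hRHq : ∀ D : DatumDualData κ γ (charModule (∅ : Set (PadicAlgCl p)) θquot)
      (bdpData (charModule (∅ : Set (PadicAlgCl p)) θquot) p vbar) (∅ : Set (HeightOneSpectrum (𝓞 K))),
      Module.Finite (IwasawaAlgebra p) D.X ∧ Module.IsTorsion (IwasawaAlgebra p) D.X ∧ muInvariant p D.X = 0 := fun D ↦
    StrictEqUnramifiedCentral.prop_datumDualData_of_forall_grDualData κ vbar ∅ heqq
      (fun (X : Type) [AddCommGroup X] [Module (IwasawaAlgebra p) X] ↦
        Module.Finite (IwasawaAlgebra p) X ∧ Module.IsTorsion (IwasawaAlgebra p) X ∧ muInvariant p X = 0) hGq D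
  obtain ⟨Dsub⟩ := nonempty_unrDualData_char (∅ : Set (PadicAlgCl p)) θsub κ vbar (∅ : Set (HeightOneSpectrum (𝓞 K))) hγ.out
  obtain ⟨Dquot⟩ := nonempty_unrDualData_char (∅ : Set (PadicAlgCl p)) θquot κ vbar (∅ : Set (HeightOneSpectrum (𝓞 K))) hγ.out
  have hc : n + ∑ w ∈ Sf, curveLocalLambda κ (W.baseChange K) w =
      lambdaInvariant p Dsub.X + lambdaInvariant p Dquot.X +
        ∑ w ∈ Sf, (charLocalLambda (∅ : Set (PadicAlgCl p)) κ θsub w + charLocalLambda (∅ : Set (PadicAlgCl p)) κ θquot w) :=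
    StrictEqUnramifiedCentral.prop_datumDualData_of_forall_grDualData κ vbar ∅ heqs
      (fun (X : Type) [AddCommGroup X] [Module (IwasawaAlgebra p) X] ↦
        n + ∑ w ∈ Sf, curveLocalLambda κ (W.baseChange K) w = lambdaInvariant p X + lambdaInvariant p Dquot.X +
          ∑ w ∈ Sf, (charLocalLambda (∅ : Set (PadicAlgCl p)) κ θsub w + charLocalLambda (∅ : Set (PadicAlgCl p)) κ θquot w))
      (fun G ↦ StrictEqUnramifiedCentral.prop_datumDualData_of_forall_grDualData κ vbar ∅ heqq
        (fun (Y : Type) [AddCommGroup Y] [Module (IwasawaAlgebra p) Y] ↦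
          n + ∑ w ∈ Sf, curveLocalLambda κ (W.baseChange K) w = lambdaInvariant p G.X + lambdaInvariant p Y +
            ∑ w ∈ Sf, (charLocalLambda (∅ : Set (PadicAlgCl p)) κ θsub w + charLocalLambda (∅ : Set (PadicAlgCl p)) κ θquot w))
        (fun G' ↦ hcount G G') Dquot) Dsub
  -- the embedding `K ↪ ℚ_p` at the degree-one prime `v`, and the door inequality ON THE NAT INDEX ROAD (FILE D)
  obtain ⟨he1, hf1⟩ := degreeOne_of_splitsIn hS.imagQuad.1 hS.split hv
  obtain ⟨h0, hineq⟩ := NATLambdaAlgebraicSide.add_add_sum_le_lambdaInvariant_xAc_empty_add_sum_curveLocalLambda_of_decomp_ne_one W hp2 hX3.2 K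
    hS.imagQuad hH (embAt K p v hv he1 hf1) v vbar (fun x ↦ mem_asIdeal_iff_norm_embAt_lt_one v hv he1 hf1 x) hS.mem_vbar hS.vbar_ne κ hS.anticyclotomic γ
    θsub θquot hpair hsubD hquotD Sf hSf' Dsub Dquot hRHs hRHq
  refine ⟨⟨n, hLn, ?_⟩, h0⟩
  omega

/-- **Keller–Yin Thm. 3.5.1 (branch currency) at `p ≥ 5`, at a signed frame, along any structure map `j`, CGLS-Cor.-1.2.6-free:** `Ch_Λ(X_ac^∅(W_K))·R₀⟦T⟧ = (L)`
and the first unit coefficient of `L` sits EXACTLY at `λ(𝔛)` — from [DIV.dvd], [AN-BR₅], CGLS Prop. 1.2.5's module clause and the NAT index road (F38b's theorem with §1 in place of its CGLS-fed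
λ-inequality and Prop. 14). [claim: KellerYin2024PotOrd, status: under-review]
[cite: KellerYin2024b, Thm. 3.3.6, Prop. 3.4.4, §3.5, Thm. 3.5.1 and Lemma 2.3.8 (arXiv:2410.23241 pp. 11, 19–20) (preprint; hypotheses and the sentence derived)]
[cite: CastellaGrossiLeeSkinner2022, Thm. 3.2.1, Thm. 1.2.2, Prop. 1.2.5] [cite: KellerYin2024, Thm. 1.4.1 (iii)] [cite: Washington1997, §7.1 Prop. 7.2 and §13.2] -/
theorem xac_charIdeal_map_eq_span_five_le_of_dvd
    (hAN : thm351_anacong_charLambda_branch_five_le)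
    (hprop125 : prop125_characterGrSelmerDual_torsion_muZero_dim)
    (hDVD : thm336_dvd_branch_OPEN)
    (hp5 : 5 ≤ p) (ι' : PadicAlgCl p ≃+* ℂ) (W : WeierstrassCurve ℚ) [W.IsElliptic] [W.IsGloballyMinimal]
    (K : Type) [Field K] [NumberField K] [IsGalois ℚ K]
    (v vbar : HeightOneSpectrum (𝓞 K)) (κ : ZpExtension K p) (γ : absoluteGaloisGroup K)
    [hγ : Fact (κ.IsTopGenerator γ)] {N : ℕ} [NeZero N] {f : CuspForm (CongruenceSubgroup.Gamma0 N) 2}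
    (hf : IsNewformOf W f) (hS : PotOrdSetting ι' W K v vbar κ N)
    (hX3 : ClassX3 W p) (hSG : SubGordTwo W p)
    (hv : ((p : ℕ) : 𝓞 K) ∈ v.asIdeal)
    {N' : ℕ} [NeZero N'] {f' : CuspForm (CongruenceSubgroup.Gamma0 N') 2} (hf' : IsNewform0 f') (hN' : ¬ p ∣ N')
    (htw : ∃ S : Finset ℕ, ∀ ℓ : ℕ, ℓ.Prime → ℓ ∉ S →
      cuspCoeff f ℓ = ((legendreSym p ℓ : ℤ) : ℂ) * cuspCoeff f' ℓ)
    {θsub θquot : FramedGaloisRep K (padicCoeffIntegers (∅ : Set (PadicAlgCl p))) 1}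
    (hpair : IsResidualPairOver (W.baseChange K) p θsub θquot)
    {e : ℂ} {ΩK : ℂ} {Ωp : (unrIntegers p)ˣ} {L : UnrSeries p} (he : e = 1 ∨ e = -1) (hΩK : ΩK ≠ 0)
    (hL : IsBranchBDPLFunction ι' v κ γ f' (KellerYin2024.genusHeckeCharacter K p) e ΩK ((Ωp : unrIntegers p) : ℂ_[p]) L)
    (j : ℤ_[p] →+* unrIntegers p)
    (hj : ∀ x : ℤ_[p], ((j x : unrIntegers p) : ℂ_[p]) = algebraMap ℚ_[p] ℂ_[p] (x : ℚ_[p])) :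
    (XAc.charIdeal (W.baseChange K) p κ vbar (∅ : Set (HeightOneSpectrum (𝓞 K))) γ).map (PowerSeries.map j) =
        Ideal.span {L} ∧
      ∃ n : ℕ, FirstUnitCoeffAt L n ∧
        n = lambdaInvariant p (XAc (W.baseChange K) p κ vbar (∅ : Set (HeightOneSpectrum (𝓞 K))) γ) := by
  -- `𝔛` torsion with `μ = 0` is RETURNED by the NAT index road (FILE D), no CGLS Prop. 14
  obtain ⟨⟨n, hLn, hle⟩, hT, hμ⟩ := exists_firstUnitCoeffAt_le_lambdaInvariant_five_le hAN hprop125 hp5 ι' W K v vbar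
    κ γ hf hS hX3 hSG hv hf' hN' htw hpair he hΩK hL
  have he0 : e ≠ 0 := by rcases he with rfl | rfl <;> norm_num
  have hΩp0 : ((Ωp : unrIntegers p) : ℂ_[p]) ≠ 0 := by
    rw [Ne, ZeroMemClass.coe_eq_zero]; exact Ωp.ne_zero
  obtain ⟨k, hk⟩ := hDVD ι' W K v vbar κ γ hf hS hf' hN' htw e ΩK _ L he0 hΩK hΩp0 hL j hj
  haveI : Module.Finite (IwasawaAlgebra p) (XAc (W.baseChange K) p κ vbar (∅ : Set (HeightOneSpectrum (𝓞 K))) γ) :=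
    XAc.module_finite_empty _ p κ vbar γ
  obtain ⟨heq, hn⟩ := charIdeal_map_eq_span_of_C_pow_mul_mem_of_firstUnitCoeff_le _ hT hμ j hj hLn hle hk
  exact ⟨heq, n, hLn, hn⟩

end FiveLe

end Summit.BirchSwinnertonDyer.BirchSwinnertonDyer.Theorems.SchneiderFreeAdditiveX3.NATGordCellFiveLe

end
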